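import Mathlib
import Summits.Ventures.PercRepro2.Defs
import Summits.Ventures.PercRepro2.Graph
import Summits.Ventures.PercRepro2.OneColourSwitch
import Summits.Ventures.PercRepro2.RegionHubSign
import Summits.Ventures.PercRepro2.SideSwitch
import Summits.Ventures.PercRepro2.TermSwitchDefs
import Summits.Ventures.PercRepro2.TermSwitchReach
import Summits.Ventures.PercRepro2.M9NoPocketDefs
import Summits.Ventures.PercRepro2.M9Unreached
import Summits.Ventures.PercRepro2.M9GeneralDSplit
import Summits.Ventures.PercRepro2.M9ReachedSum
import Summits.Ventures.PercRepro2.M9FourParts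
import Summits.Ventures.PercRepro2.M9ReachedK

/-!
# The sharpened crux `2·EX + HD ≤ 0` and what it buys (blind cell PercRepro2, p3 g33,
2026-08-28; `proofs/P3-BSTAR.md` §9)

The record's crux ⟦EXHD⟧ is `exSum + hdSum ≤ 0`; the census says more: **`2·exSum + hdSum ≤ 0`**
(⟦2EXHD⟧, tight on a whole family — e.g. `n = 9`, edges 60 80 81 38 73 84 45 25 06 75 57 27 06
has `EX = 64`, `HD = −128`), equivalently `hdKSum + exSum ≤ 0`: the DIRTY one-sided `K`-points
alone pay the doubly-reached points.  Proved here, as identity-level reductions: ⟦2EXHD⟧ implies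
the single-`d` statement in every class (`dSignSum_nonpos_of_two_ex_add_hd`: for `EX ≤ 0` by
REACH, `dSignSum ≤ EX + N`; for `EX > 0` by `dSignSum ≤ HD ≤ −2·EX`), implies ⟦EXHD⟧ when
`EX ≥ 0`, and with the three-terminal theorem `L_z + EX ≤ 0` implies the `3/2`-form
**`3·exSum + 2·kOnlySum ≤ 0`** (`three_ex_add_two_kOnly_nonpos_of_two_ex_add_hd`), i.e.
`kOnlySum ≤ −(3/2)·exSum`: the extreme ratio `−kOnly/EX = 3/2` of the census.  Own work; std
axioms.
-/

namespace Summit.Ventures.PercRepro2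

namespace NoPocket

open Finset Classical RegionHub OneColourSwitch SideSwitch TermSwitch

variable {V : Type*} {E : Type*}

section TwoExHd

variable [Fintype V] [DecidableEq V] [Fintype E] [DecidableEq E] {ends : E → Sym2 V}
  {p q r s d : V}

omit [Fintype V] [DecidableEq V] in
/-- **The three-terminal part is the clean reached part plus the doubly-reached part**:
`L = L_z + EX`, from the two decompositions of `dSignSum`. -/
theorem cleanReachedSum_add_exSum_eq :
    cleanReachedSum ends p q r s d + exSum ends p q r s d =
      dzeroSignSumHP ends p q r s ({r, s, d} : Set V) (Reached ends r s d) := by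
  have h1 := dSignSum_eq_four_parts (ends := ends) (p := p) (q := q) (r := r) (s := s) (d := d)
  have h2 := dSignSum_eq_unreached_add_reached_add_hd (ends := ends) (p := p) (q := q) (r := r)
    (s := s) (d := d)
  linarith

/-- **`L_z + EX ≤ 0`** (the three-terminal theorem in the four-part vocabulary). -/
theorem cleanReachedSum_add_exSum_nonpos (hr : d ≠ r) (hs : d ≠ s) :
    cleanReachedSum ends p q r s d + exSum ends p q r s d ≤ 0 := by
  rw [cleanReachedSum_add_exSum_eq]
  exact dzeroSignSumHP_reached_nonpos (ends := ends) p q hr.symm hs.symm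

/-- **The single-`d` statement from ⟦2EXHD⟧** `2·EX + HD ≤ 0`, for every non-mark `d ≠ r, s`
(no `T`-free hypothesis): when `EX ≤ 0`, `dSignSum ≤ EX + N ≤ 0` (REACH); when `EX > 0`,
`dSignSum ≤ HD ≤ −2·EX < 0`. -/
theorem dSignSum_nonpos_of_two_ex_add_hd (hr : d ≠ r) (hs : d ≠ s)
    (h : 2 * exSum ends p q r s d + hdSum ends p q r s d ≤ 0) :
    dSignSum ends p q r s d ≤ 0 := by
  rcases le_or_gt (exSum ends p q r s d) 0 with hex | hex
  · have h1 := dSignSum_le_ex_add_unreached (ends := ends) (p := p) (q := q) hr hs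
    have h2 := unreachedSum_nonpos (ends := ends) (p := p) (q := q) (r := r) (s := s) (d := d)
    linarith
  · have h1 := dSignSum_le_hdSum (ends := ends) (p := p) (q := q) hr.symm hs.symm
    linarith

omit [Fintype V] [DecidableEq V] in
/-- ⟦2EXHD⟧ implies the record's ⟦EXHD⟧ `EX + HD ≤ 0` whenever `EX ≥ 0`. -/
theorem ex_add_hd_nonpos_of_two_ex_add_hd (hex : 0 ≤ exSum ends p q r s d)
    (h : 2 * exSum ends p q r s d + hdSum ends p q r s d ≤ 0) :
    exSum ends p q r s d + hdSum ends p q r s d ≤ 0 := by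
  linarith

/-- **The `3/2`-form**: ⟦2EXHD⟧ and `L_z + EX ≤ 0` give `3·EX + 2·kOnly ≤ 0`, i.e.
`kOnlySum ≤ −(3/2)·exSum` (`2·kOnly = L_z + HD` by REACH's identity and the colour flip). -/
theorem three_ex_add_two_kOnly_nonpos_of_two_ex_add_hd (hr : d ≠ r) (hs : d ≠ s)
    (h : 2 * exSum ends p q r s d + hdSum ends p q r s d ≤ 0) :
    3 * exSum ends p q r s d + 2 * kOnlySum ends p q r s d ≤ 0 := by
  have h1 := cleanReachedSum_add_exSum_nonpos (ends := ends) (p := p) (q := q) hr hs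
  have h2 := reachedOneSum_eq_kOnly_add_mOnly (ends := ends) (p := p) (q := q) (r := r) (s := s)
    (d := d)
  have h3 := mOnlySum_eq_kOnlySum (ends := ends) (p := p) (q := q) (r := r) (s := s) (d := d)
  have h4 := reachedOneSum_eq_clean_add_hd (ends := ends) (p := p) (q := q) (r := r) (s := s)
    (d := d)
  linarith

/-- ⟦2EXHD⟧ implies (RK) `reachedKSum = kOnly + EX ≤ 0` — through the `3/2`-form and
`kOnlySum ≤ 0`. -/
theorem reachedKSum_nonpos_of_two_ex_add_hd (hr : d ≠ r) (hs : d ≠ s)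
    (h : 2 * exSum ends p q r s d + hdSum ends p q r s d ≤ 0) :
    reachedKSum ends p q r s d ≤ 0 := by
  rw [reachedKSum_eq_kOnly_add_ex]
  have h1 := three_ex_add_two_kOnly_nonpos_of_two_ex_add_hd (ends := ends) (p := p) (q := q)
    hr hs h
  have h2 := kOnlySum_nonpos (ends := ends) (p := p) (q := q) hr hs
  linarith

end TwoExHd

end NoPocket

end Summit.Ventures.PercRepro2
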